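/-
Copyright (c) 2026 the pub-hodgecm-mathlib formalisation cell (harness21).  Prover seat hodgecm-mathlib-K2Liu-p10 (g4), Track B «K2-LIT»,
#184♮ = hLiu418 = `stmt-HodgeConjecture-24832`; organ S2 «ARCH SPAN BY K-TYPE PATHS» (LEAD F0P6-plan (g14) RULINGS M-158e∕M-158f, DESIGN-S2 41bd43fff4457fcc,
BATCH #6 (9) «S2-K = K2Liu-p10», BATCH #7 (c) «work UPSTAIRS»): the DEFS leaf of S2-K — carrier, coordinates, formal partials, K-types, operators.
-/
import Mathlib.RingTheory.Localization.Away.Basic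
import Mathlib.Algebra.MvPolynomial.PDeriv
import Mathlib.RingTheory.Derivation.Basic
import Mathlib.Algebra.TrivSqZeroExt.Basic
import Mathlib.Data.Complex.Basic
import Mathlib.LinearAlgebra.Matrix.Adjugate
import Mathlib.Data.Matrix.Basic
import HarnessLib

/-!
# Crux `HLiu418`, organ S2, DEFS leaf (S2-K): THE COMPACT-PICTURE RING `𝒜 = ℂ[u_{ij}, D⁻¹]` OF `U(2)` UPSTAIRS — carrier, coordinates `u`, `D⁻¹`, the formal
# partials `∂_{ij}`, the explicit K-types `W_{(k+l,l)} = D^l · span{(ξ·u·η)^k}`, and the named operators `R_{ab}`, `L_{ab}`, Euler, Casimir, `P_{ab}`, `M_{ab}`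

Cell `hodgecm-mathlib`, crux item hLiu418 = `stmt-HodgeConjecture-24832`, route of record `HCCMUnconditional`; squad K2 ∕ K2Liu, prover K2Liu-p10 (g4).
DEFINITIONS WITH BODIES + unfolding theorems; no instance, no notation, no named fact, no `sorry`; lane `--supports stmt-HodgeConjecture-24832 --as helper`.
Census `K2/K2Liu-p10/g4/CENSUS-S2K-CompactPictureKTypes.K2Liu-p10-g4.md` (8412f86940febae5).

THE MODEL (DESIGN-S2 §3 (i), ref1 PREP-S2 §1, TESTVECTORS-S2T §1∕§3, BATCH #7 (c)).  The `K_w`-finite vectors of the archimedean degenerate principal series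
`I_w(s, χ_w)` of `U(2,2)` read in the compact picture on the Shilov boundary `U(2) ∋ u` are the Laurent-polynomial functions `ℂ[u_{ij}, det(u)⁻¹]`
([LeeZhu1998, p. 5032]; [KashiwaraVergne1978, §II.5]).  We work UPSTAIRS with the ABSTRACT ring — no functions, no topology —
* §1 GENERIC LETTERS over any commutative `ℂ`-algebra `R` with a matrix of elements `u`, an element `Dinv` and derivations `∂ i j` (the interface S2-T is typed against):
  `dMat ∂ Y` (`∂_Y = Σ Y_{ij} ∂_{ij}`), the right∕left `𝔤𝔩₂` fields **`rOp ∂ u a b = Σ_k u_{ka} ∂_{kb}`**, **`lOp ∂ u a b = Σ_k u_{bk} ∂_{ak}`**, **`euler`**, **`casimir`** (right),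
  Weil's **`pOp`** (`P_{ab} = p·(u⁻¹)_{ba} − ∂_{ab}`, 𝔭⁺) and **`mOp`** (`M_{ab} = q·u_{ba} + Σ u_{ia}u_{bj}∂_{ij}`, 𝔭⁻) with FREE scalars `p q`, the bilinear coordinates
  **`bil u ξ η = Σ ξ_i η_j u_{ij}`** (`ξ` a ROW, `η` a COLUMN vector), the test family **`fkl u Dz k l = u₀₀^k · Dz l`** and its harmonic companion **`hk u k`**;
* §2 THE CARRIER **`Carrier := Localization.Away detPoly`**, `detPoly = X₀₀X₁₁ − X₀₁X₁₀ ∈ MvPolynomial (Fin 2 × Fin 2) ℂ` — THE ring `ℂ[u_{ij}, D⁻¹]`; the coordinates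
  **`uMat`**, **`dInv`**, the unit powers **`dz : ℤ → Carrier`**;
* §3 THE FORMAL PARTIALS **`pd i j : Derivation ℂ Carrier Carrier`** — the unique extension of `MvPolynomial.pderiv (i, j)` through the localisation, constructed by lifting
  `P ↦ (P, ∂P)` into the dual numbers `Carrier[ε]` (`D ↦ (D, ∂D)` is a unit there); `pd_algebraMap`, `pd_uMat`, `pd_dInv`;
* §4 THE EXPLICIT K-TYPES **`kType k l := span ℂ {dz l * (bil uMat ξ η)^k}`** (label dictionary `λ = (k + l, l)`, `λ₂ = l ∈ ℤ` may be negative — ref1 (c2)) and the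
  highest-weight line `fkl uMat dz k l ∈ kType k l`;
* §5 EVALUATION **`evalAt g hg : Carrier →ₐ[ℂ] ℂ`** at a complex matrix with `det g ≠ 0` (the restriction map `res` of BATCH #7 (c) is `a ↦ (u ↦ evalAt u _ a)`).
NOT here (theorem files K-1∕K-2∕K-3 of S2-K): stability of `kType` under `rOp`∕`lOp`, the ten memberships of TESTVECTORS (n1), the decomposition `⨁ kType = ⊤`, the structure
lemma for `𝔨_ℂ`-stable subspaces, the chain rule through `evalAt`.

HONEST LABEL: HC_CM is proved only modulo the 7 printed citations (2 remaining named inputs: hLiu418 = stmt-HodgeConjecture-24832, h413 = stmt-HodgeConjecture-24833)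
until rung 0 closes; this file defines carriers and closes no item.
References: [LeeZhu1998] S. T. Lee, C.-B. Zhu, Trans. AMS 350 (1998) 5017–5046, p. 5032 (K-types of `I(s;ν)`, multiplicity one, transition coefficients);
[KashiwaraVergne1978] M. Kashiwara, M. Vergne, Invent. Math. 44 (1978), §II.5 (pluriharmonic polynomials, `GL × GL` decomposition of polynomial functions on matrices);
[Weil1964] n° 6 (`P = MN`, the generators); [Howe1989Remarks] R. Howe, *Remarks on classical invariant theory*, Trans. AMS 313 (1989) §2 (polynomial `GL_n × GL_m` duality).
-/

set_option autoImplicit false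
set_option linter.dupNamespace false -- the mandated namespace repeats `HodgeConjecture.HodgeConjecture`

noncomputable section

open MvPolynomial Matrix

namespace Summit.HodgeConjecture.HodgeConjecture.Cruxes.HLiu418.K2LiuU22CompactPictureDefs

/-! ## §1 Generic letters: operators over any `(R, u, Dinv, ∂)` -/

section Generic

variable {R : Type*} [CommRing R] [Algebra ℂ R] (d : Fin 2 → Fin 2 → Derivation ℂ R R) (u : Matrix (Fin 2) (Fin 2) R) (Dinv : R)

/-- the derivation along a coefficient matrix: `d_Y F = Σ_{ij} Y_{ij} d_{ij} F`. [cite: LeeZhu1998, p. 5032] -/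
def dMat (Y : Matrix (Fin 2) (Fin 2) R) : R →ₗ[ℂ] R :=
  ∑ i : Fin 2, ∑ j : Fin 2, (LinearMap.mulLeft ℂ (Y i j)) ∘ₗ (d i j).toLinearMap

/-- unfolding. [cite: LeeZhu1998, p. 5032] -/
theorem dMat_apply (Y : Matrix (Fin 2) (Fin 2) R) (F : R) : dMat d Y F = ∑ i : Fin 2, ∑ j : Fin 2, Y i j * d i j F := by
  simp [dMat]

/-- **the RIGHT `𝔤𝔩₂` vector field `R_{ab} = d_{u E_{ab}} = Σ_k u_{ka} d_{kb}`** (right translation `u ↦ u·exp(tE_{ab})`). [cite: LeeZhu1998, p. 5032] [cite: KashiwaraVergne1978, §II.5] -/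
def rOp (a b : Fin 2) : R →ₗ[ℂ] R :=
  ∑ k : Fin 2, (LinearMap.mulLeft ℂ (u k a)) ∘ₗ (d k b).toLinearMap

/-- unfolding. [cite: LeeZhu1998, p. 5032] -/
theorem rOp_apply (a b : Fin 2) (F : R) : rOp d u a b F = ∑ k : Fin 2, u k a * d k b F := by
  simp [rOp]

/-- **the LEFT `𝔤𝔩₂` vector field `L_{ab} = d_{E_{ab} u} = Σ_k u_{bk} d_{ak}`** (left translation `u ↦ exp(tE_{ab})·u`). [cite: LeeZhu1998, p. 5032] [cite: KashiwaraVergne1978, §II.5] -/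
def lOp (a b : Fin 2) : R →ₗ[ℂ] R :=
  ∑ k : Fin 2, (LinearMap.mulLeft ℂ (u b k)) ∘ₗ (d a k).toLinearMap

/-- unfolding. [cite: LeeZhu1998, p. 5032] -/
theorem lOp_apply (a b : Fin 2) (F : R) : lOp d u a b F = ∑ k : Fin 2, u b k * d a k F := by
  simp [lOp]

/-- **the Euler operator `E = Σ_{ij} u_{ij} d_{ij}`** (`= Σ_a R_{aa} = Σ_a L_{aa}`; degree on polynomials, `−2` on `D⁻¹`). [cite: KashiwaraVergne1978, §II.5] -/
def euler : R →ₗ[ℂ] R :=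
  dMat d u

/-- unfolding. [cite: KashiwaraVergne1978, §II.5] -/
theorem euler_apply (F : R) : euler d u F = ∑ i : Fin 2, ∑ j : Fin 2, u i j * d i j F :=
  dMat_apply d u F

/-- **the right Casimir `C = Σ_{ab} R_{ab} R_{ba}`** of `𝔤𝔩₂` (joint with `E` it separates the K-types). [cite: LeeZhu1998, p. 5032] -/
def casimir : R →ₗ[ℂ] R :=
  ∑ a : Fin 2, ∑ b : Fin 2, rOp d u a b ∘ₗ rOp d u b a

/-- unfolding. [cite: LeeZhu1998, p. 5032] -/
theorem casimir_apply (F : R) : casimir d u F = ∑ a : Fin 2, ∑ b : Fin 2, rOp d u a b (rOp d u b a F) := by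
  simp [casimir]

/-- **Weil's `𝔭⁺` operator `P_{ab} F = p·(u⁻¹)_{ba}·F − d_{ab} F`** with `(u⁻¹)_{ba} = Dinv · adj(u)_{ba}` and a FREE scalar `p` (`= s+1+κ∕2` in S2-P).
[cite: LeeZhu1998, p. 5032, eq. before (5.3)] -/
def pOp (p : ℂ) (a b : Fin 2) : R →ₗ[ℂ] R :=
  p • LinearMap.mulLeft ℂ (Dinv * u.adjugate b a) - (d a b).toLinearMap

/-- unfolding. [cite: LeeZhu1998, p. 5032] -/
theorem pOp_apply (p : ℂ) (a b : Fin 2) (F : R) : pOp d u Dinv p a b F = p • (Dinv * u.adjugate b a * F) - d a b F := by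
  simp [pOp, mul_assoc]

/-- **Weil's `𝔭⁻` operator `M_{ab} F = q·u_{ba}·F + Σ_{ij} u_{ia} u_{bj} d_{ij} F`** with a FREE scalar `q` (`= s+1−κ∕2` in S2-P). [cite: LeeZhu1998, p. 5032, eq. before (5.3)] -/
def mOp (q : ℂ) (a b : Fin 2) : R →ₗ[ℂ] R :=
  q • LinearMap.mulLeft ℂ (u b a) + ∑ i : Fin 2, ∑ j : Fin 2, (LinearMap.mulLeft ℂ (u i a * u b j)) ∘ₗ (d i j).toLinearMap

/-- unfolding. [cite: LeeZhu1998, p. 5032] -/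
theorem mOp_apply (q : ℂ) (a b : Fin 2) (F : R) : mOp d u q a b F = q • (u b a * F) + ∑ i : Fin 2, ∑ j : Fin 2, u i a * u b j * d i j F := by
  simp [mOp, mul_assoc]

/-- **the bilinear coordinate `ξ·u·η = Σ_{ij} ξ_i η_j u_{ij}`** (`ξ` a row vector, `η` a column vector, independent). [cite: KashiwaraVergne1978, §II.5] [cite: Howe1989Remarks, §2] -/
def bil (ξ η : Fin 2 → ℂ) : R :=
  ∑ i : Fin 2, ∑ j : Fin 2, (ξ i * η j) • u i j

/-- unfolding. [cite: KashiwaraVergne1978, §II.5] -/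
theorem bil_apply (ξ η : Fin 2 → ℂ) : bil u ξ η = ∑ i : Fin 2, ∑ j : Fin 2, (ξ i * η j) • u i j :=
  rfl

/-- **the test family `F_{k,l} = u₀₀^k · D^l`** (`Dz : ℤ → R` the powers of `D`; highest weight `(k+l, l)` for the right `U(2)`). [cite: LeeZhu1998, p. 5032] -/
def fkl (Dz : ℤ → R) (k : ℕ) (l : ℤ) : R :=
  u 0 0 ^ k * Dz l

omit [Algebra ℂ R] in
/-- unfolding. [cite: LeeZhu1998, p. 5032] -/
theorem fkl_apply (Dz : ℤ → R) (k : ℕ) (l : ℤ) : fkl u Dz k l = u 0 0 ^ k * Dz l :=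
  rfl

/-- **the harmonic companion `H_k = u₀₀^k u₁₁ + k·u₀₀^{k−1} u₀₁ u₁₀`** (Cayley-harmonic; `(k+1) H_k` is the `ξ₀^kξ₁η₀^kη₁`-coefficient of `(ξuη)^{k+1}`; the factor `k` in front
makes `k = 0` need no side condition). [cite: KashiwaraVergne1978, §II.5] -/
def hk (k : ℕ) : R :=
  u 0 0 ^ k * u 1 1 + (k : ℂ) • (u 0 0 ^ (k - 1) * u 0 1 * u 1 0)

/-- unfolding. [cite: KashiwaraVergne1978, §II.5] -/
theorem hk_apply (k : ℕ) : hk u k = u 0 0 ^ k * u 1 1 + (k : ℂ) • (u 0 0 ^ (k - 1) * u 0 1 * u 1 0) :=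
  rfl

end Generic

/-! ## §2 The carrier `𝒜 = ℂ[u_{ij}, D⁻¹]` -/

/-- the determinant polynomial `D = X₀₀X₁₁ − X₀₁X₁₀ ∈ ℂ[X_{ij}]`. [cite: KashiwaraVergne1978, §II.5] -/
def detPoly : MvPolynomial (Fin 2 × Fin 2) ℂ :=
  X (0, 0) * X (1, 1) - X (0, 1) * X (1, 0)

/-- **THE CARRIER `𝒜 := ℂ[X_{ij}][D⁻¹]`** — the localisation of the polynomial ring in the four matrix entries away from the determinant (the ring of `K`-finite functions
of the compact picture, UPSTAIRS). [cite: LeeZhu1998, p. 5032] [cite: KashiwaraVergne1978, §II.5] -/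
abbrev Carrier : Type :=
  Localization.Away detPoly

/-- the coordinate matrix `u = (u_{ij})`, `u_{ij} := X_{ij} ∈ 𝒜`. [cite: LeeZhu1998, p. 5032] -/
def uMat : Matrix (Fin 2) (Fin 2) Carrier :=
  fun i j => algebraMap (MvPolynomial (Fin 2 × Fin 2) ℂ) Carrier (X (i, j))

/-- unfolding. [cite: LeeZhu1998, p. 5032] -/
theorem uMat_apply (i j : Fin 2) : uMat i j = algebraMap (MvPolynomial (Fin 2 × Fin 2) ℂ) Carrier (X (i, j)) :=
  rfl

/-- `det u` is the image of `D`. [cite: KashiwaraVergne1978, §II.5] -/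
theorem det_uMat : uMat.det = algebraMap (MvPolynomial (Fin 2 × Fin 2) ℂ) Carrier detPoly := by
  rw [Matrix.det_fin_two]
  simp only [detPoly, map_sub, map_mul, uMat_apply]

/-- the inverse `D⁻¹ ∈ 𝒜`. [cite: LeeZhu1998, p. 5032] -/
def dInv : Carrier :=
  IsLocalization.Away.invSelf detPoly

/-- `det u · D⁻¹ = 1`. [cite: LeeZhu1998, p. 5032] -/
theorem det_uMat_mul_dInv : uMat.det * dInv = 1 := by
  rw [det_uMat, dInv, IsLocalization.Away.mul_invSelf]

/-- `det u` is a unit of `𝒜`. [cite: LeeZhu1998, p. 5032] -/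
theorem isUnit_det_uMat : IsUnit uMat.det :=
  isUnit_iff_exists_inv.2 ⟨dInv, det_uMat_mul_dInv⟩

/-- **the powers `D^l`, `l ∈ ℤ`** (unit powers: `dz l = (det u)^l` for `l ≥ 0`, `= (D⁻¹)^{−l}` for `l ≤ 0`). [cite: LeeZhu1998, p. 5032] -/
def dz (l : ℤ) : Carrier :=
  ((isUnit_det_uMat.unit ^ l : Carrierˣ) : Carrier)

/-- `dz 0 = 1`. [folklore] -/
theorem dz_zero : dz 0 = 1 := by
  simp [dz]

/-- `dz (l + m) = dz l * dz m`. [folklore] -/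
theorem dz_add (l m : ℤ) : dz (l + m) = dz l * dz m := by
  simp [dz, zpow_add]

/-- `dz n = (det u)^n` for `n : ℕ`. [folklore] -/
theorem dz_natCast (n : ℕ) : dz n = uMat.det ^ n := by
  simp [dz]

/-- `dz 1 = det u`. [folklore] -/
theorem dz_one : dz 1 = uMat.det := by
  simpa using dz_natCast 1

/-- `dz (−1) = D⁻¹`. [folklore] -/
theorem dz_neg_one : dz (-1) = dInv := by
  have h1 : dz 1 * dInv = 1 := by rw [dz_one, det_uMat_mul_dInv]
  have h2 : dz (-1) * dz 1 = 1 := by rw [← dz_add]; simp [dz_zero]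
  calc dz (-1) = dz (-1) * (dz 1 * dInv) := by rw [h1, mul_one]
    _ = dInv := by rw [← mul_assoc, h2, one_mul]

/-- `dz (−n) = (D⁻¹)^n` for `n : ℕ`. [folklore] -/
theorem dz_neg_natCast (n : ℕ) : dz (-(n : ℤ)) = dInv ^ n := by
  induction n with
  | zero => simp [dz_zero]
  | succ n ih => rw [Nat.cast_succ, neg_add, dz_add, ih, dz_neg_one, pow_succ]

/-! ## §3 The formal partials `∂_{ij}` on `𝒜` (the unique extension of `pderiv` through the localisation) -/

/-- the first-order lift `P ↦ (P, ∂_{ij}P)` of the polynomial ring into the dual numbers over `𝒜`. [folklore] -/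
def pdLift (ij : Fin 2 × Fin 2) : MvPolynomial (Fin 2 × Fin 2) ℂ →ₐ[ℂ] TrivSqZeroExt Carrier Carrier :=
  MvPolynomial.aeval fun kl => TrivSqZeroExt.inl (algebraMap (MvPolynomial (Fin 2 × Fin 2) ℂ) Carrier (X kl)) +
    (if kl = ij then TrivSqZeroExt.inr 1 else 0)

/-- the first component of the lift is the localisation map. [folklore] -/
theorem fst_pdLift (ij : Fin 2 × Fin 2) (P : MvPolynomial (Fin 2 × Fin 2) ℂ) :
    (pdLift ij P).fst = algebraMap (MvPolynomial (Fin 2 × Fin 2) ℂ) Carrier P := by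
  have h : (TrivSqZeroExt.fstHom ℂ Carrier Carrier).comp (pdLift ij) = IsScalarTower.toAlgHom ℂ (MvPolynomial (Fin 2 × Fin 2) ℂ) Carrier := by
    refine MvPolynomial.algHom_ext fun kl => ?_
    simp only [AlgHom.comp_apply, pdLift, MvPolynomial.aeval_X, IsScalarTower.toAlgHom_apply]
    split_ifs <;> simp [TrivSqZeroExt.fstHom]
  exact AlgHom.congr_fun h P

/-- the second component of the lift is `pderiv`. [folklore] -/
theorem snd_pdLift (ij : Fin 2 × Fin 2) (P : MvPolynomial (Fin 2 × Fin 2) ℂ) :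
    (pdLift ij P).snd = algebraMap (MvPolynomial (Fin 2 × Fin 2) ℂ) Carrier (pderiv ij P) := by
  induction P using MvPolynomial.induction_on with
  | C c =>
    rw [pdLift, MvPolynomial.algHom_C, pderiv_C, map_zero]
    rfl
  | add p q hp hq => rw [map_add, TrivSqZeroExt.snd_add, hp, hq, map_add, map_add]
  | mul_X p kl hp =>
    have hX : (pdLift ij (X kl)).snd = algebraMap (MvPolynomial (Fin 2 × Fin 2) ℂ) Carrier (pderiv ij (X kl)) := by
      rw [pdLift, MvPolynomial.aeval_X, TrivSqZeroExt.snd_add, TrivSqZeroExt.snd_inl, zero_add, pderiv_X]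
      split_ifs with h
      · subst h; simp [Pi.single_eq_same]
      · rw [Pi.single_eq_of_ne h, map_zero]; rfl
    rw [map_mul, TrivSqZeroExt.snd_mul, hp, fst_pdLift, fst_pdLift, hX, Derivation.leibniz]
    simp only [smul_eq_mul, map_add, map_mul, MulOpposite.smul_eq_mul_unop, MulOpposite.unop_op]
    ring

/-- `D ↦ (D, ∂D)` is a unit of the dual numbers (its first component `D` is a unit of `𝒜`). [folklore] -/
theorem isUnit_pdLift_detPoly (ij : Fin 2 × Fin 2) : IsUnit (pdLift ij detPoly) := by
  rw [TrivSqZeroExt.isUnit_iff_isUnit_fst, fst_pdLift, ← det_uMat]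
  exact isUnit_det_uMat

/-- the lift extended through the localisation: `𝒜 → 𝒜[ε]`. [folklore] -/
def pdLiftAway (ij : Fin 2 × Fin 2) : Carrier →+* TrivSqZeroExt Carrier Carrier :=
  IsLocalization.Away.lift detPoly (g := (pdLift ij).toRingHom) (isUnit_pdLift_detPoly ij)

/-- the extended lift on the image of a polynomial. [folklore] -/
theorem pdLiftAway_algebraMap (ij : Fin 2 × Fin 2) (P : MvPolynomial (Fin 2 × Fin 2) ℂ) :
    pdLiftAway ij (algebraMap (MvPolynomial (Fin 2 × Fin 2) ℂ) Carrier P) = pdLift ij P :=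
  IsLocalization.Away.lift_eq detPoly (isUnit_pdLift_detPoly ij) P

/-- the first component of the extended lift is the identity. [folklore] -/
theorem fst_pdLiftAway (ij : Fin 2 × Fin 2) (a : Carrier) : (pdLiftAway ij a).fst = a := by
  have h : (TrivSqZeroExt.fstHom ℂ Carrier Carrier).toRingHom.comp (pdLiftAway ij) = RingHom.id Carrier := by
    refine IsLocalization.ringHom_ext (Submonoid.powers detPoly) (RingHom.ext fun P => ?_)
    simp only [RingHom.comp_apply, RingHom.id_apply, pdLiftAway_algebraMap]
    exact fst_pdLift ij P
  exact RingHom.congr_fun h a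

/-- the extended lift on scalars. [folklore] -/
theorem pdLiftAway_algebraMap_complex (ij : Fin 2 × Fin 2) (c : ℂ) :
    pdLiftAway ij (algebraMap ℂ Carrier c) = TrivSqZeroExt.inl (algebraMap ℂ Carrier c) := by
  rw [IsScalarTower.algebraMap_apply ℂ (MvPolynomial (Fin 2 × Fin 2) ℂ) Carrier, pdLiftAway_algebraMap, MvPolynomial.algebraMap_eq, pdLift,
    MvPolynomial.algHom_C]
  rfl

/-- **THE FORMAL PARTIAL `∂_{ij} : 𝒜 → 𝒜`** — a `ℂ`-derivation of `𝒜 = ℂ[u, D⁻¹]`, the second component of the extended first-order lift; it extends `pderiv (i, j)` and is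
determined by that (derivations extend uniquely through localisations). [cite: LeeZhu1998, p. 5032] [cite: KashiwaraVergne1978, §II.5] -/
def pd (i j : Fin 2) : Derivation ℂ Carrier Carrier where
  toFun a := (pdLiftAway (i, j) a).snd
  map_add' a b := by
    show (pdLiftAway (i, j) (a + b)).snd = (pdLiftAway (i, j) a).snd + (pdLiftAway (i, j) b).snd
    rw [map_add]
    rfl
  map_smul' c a := by
    show (pdLiftAway (i, j) (c • a)).snd = c • (pdLiftAway (i, j) a).snd
    rw [Algebra.smul_def, map_mul, pdLiftAway_algebraMap_complex, TrivSqZeroExt.snd_mul, TrivSqZeroExt.fst_inl, TrivSqZeroExt.snd_inl, smul_zero, add_zero,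
      smul_eq_mul, Algebra.smul_def]
  map_one_eq_zero' := by
    show (pdLiftAway (i, j) 1).snd = 0
    rw [map_one]
    rfl
  leibniz' a b := by
    show (pdLiftAway (i, j) (a * b)).snd = a • (pdLiftAway (i, j) b).snd + b • (pdLiftAway (i, j) a).snd
    rw [map_mul, TrivSqZeroExt.snd_mul, fst_pdLiftAway, fst_pdLiftAway]
    simp only [MulOpposite.smul_eq_mul_unop, MulOpposite.unop_op, smul_eq_mul]
    ring

/-- unfolding. [folklore] -/
theorem pd_apply (i j : Fin 2) (a : Carrier) : pd i j a = (pdLiftAway (i, j) a).snd :=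
  rfl

/-- **`∂_{ij}` EXTENDS `pderiv`**: `∂_{ij} (P) = (pderiv (i,j) P)` on the image of the polynomial ring. [cite: KashiwaraVergne1978, §II.5] -/
theorem pd_algebraMap (i j : Fin 2) (P : MvPolynomial (Fin 2 × Fin 2) ℂ) :
    pd i j (algebraMap (MvPolynomial (Fin 2 × Fin 2) ℂ) Carrier P) = algebraMap (MvPolynomial (Fin 2 × Fin 2) ℂ) Carrier (pderiv (i, j) P) := by
  rw [pd_apply, pdLiftAway_algebraMap, snd_pdLift]

/-- **`∂_{ij} u_{kl} = δ_{(i,j),(k,l)}`** — the interface hypothesis `h∂` of the generic letters. [cite: LeeZhu1998, p. 5032] -/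
theorem pd_uMat (i j k l : Fin 2) : pd i j (uMat k l) = if i = k ∧ j = l then 1 else 0 := by
  rw [uMat_apply, pd_algebraMap, pderiv_X]
  by_cases h : i = k ∧ j = l
  · obtain ⟨rfl, rfl⟩ := h
    simp
  · rw [if_neg h, Pi.single_eq_of_ne, map_zero]
    intro hkl
    exact h ⟨(Prod.mk.inj hkl).1.symm, (Prod.mk.inj hkl).2.symm⟩

/-- **`∂_{ij} D⁻¹ = −D⁻² · ∂_{ij} det u`** (Leibniz on `det u · D⁻¹ = 1`). [folklore] -/
theorem pd_dInv (i j : Fin 2) : pd i j dInv = -(dInv * dInv) * pd i j uMat.det := by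
  have h := congrArg (pd i j) det_uMat_mul_dInv
  rw [Derivation.leibniz, Derivation.map_one_eq_zero, smul_eq_mul, smul_eq_mul] at h
  have h2 : pd i j dInv = dInv * (uMat.det * pd i j dInv) := by rw [← mul_assoc, mul_comm dInv, det_uMat_mul_dInv, one_mul]
  rw [h2, eq_neg_of_add_eq_zero_left h]
  ring

/-! ## §4 The explicit K-types -/

/-- **THE K-TYPE `W_{(k+l, l)} := D^l · span_ℂ {(ξ·u·η)^k : ξ, η ∈ ℂ²}`** — the `GL₂ × GL₂`-isotypic piece of `ℂ[u, D⁻¹]` of bi-type `(det^l ⊗ Sym^k)^∨ ⊠ (det^l ⊗ Sym^k)`,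
dimension `(k+1)²`, multiplicity ONE; label dictionary `λ = (λ₁, λ₂) = (k + l, l)` (right `U(2)` highest weight; `λ₂ < 0` allowed).
[cite: LeeZhu1998, p. 5032] [cite: KashiwaraVergne1978, §II.5] [cite: Howe1989Remarks, §2] -/
def kType (k : ℕ) (l : ℤ) : Submodule ℂ Carrier :=
  Submodule.span ℂ {f | ∃ ξ η : Fin 2 → ℂ, f = dz l * bil uMat ξ η ^ k}

/-- generators lie in the K-type. [cite: KashiwaraVergne1978, §II.5] -/
theorem dz_mul_bil_pow_mem_kType (k : ℕ) (l : ℤ) (ξ η : Fin 2 → ℂ) : dz l * bil uMat ξ η ^ k ∈ kType k l :=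
  Submodule.subset_span ⟨ξ, η, rfl⟩

/-- `ξ = η = e₀` gives `ξ·u·η = u₀₀`. [cite: KashiwaraVergne1978, §II.5] -/
theorem bil_single_zero_zero {R : Type*} [CommRing R] [Algebra ℂ R] (u : Matrix (Fin 2) (Fin 2) R) :
    bil u (Pi.single 0 1) (Pi.single 0 1) = u 0 0 := by
  simp [bil, Fin.sum_univ_two]

/-- **the highest-weight line: `F_{k,l} = u₀₀^k D^l ∈ W_{(k+l,l)}`**. [cite: LeeZhu1998, p. 5032] -/
theorem fkl_mem_kType (k : ℕ) (l : ℤ) : fkl uMat dz k l ∈ kType k l := by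
  rw [fkl_apply, mul_comm, ← bil_single_zero_zero uMat]
  exact dz_mul_bil_pow_mem_kType k l _ _

/-! ## §5 Evaluation at an invertible complex matrix (the restriction map, pointwise) -/

/-- evaluation of `D` at a matrix is its determinant. [cite: KashiwaraVergne1978, §II.5] -/
theorem aeval_detPoly (g : Matrix (Fin 2) (Fin 2) ℂ) : MvPolynomial.aeval (fun kl : Fin 2 × Fin 2 => g kl.1 kl.2) detPoly = g.det := by
  rw [detPoly, Matrix.det_fin_two]
  simp

/-- the image of `D` under evaluation at `g` with `det g ≠ 0` is a unit. [cite: KashiwaraVergne1978, §II.5] -/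
theorem isUnit_aeval_detPoly (g : Matrix (Fin 2) (Fin 2) ℂ) (hg : g.det ≠ 0) :
    IsUnit ((MvPolynomial.aeval fun kl : Fin 2 × Fin 2 => g kl.1 kl.2).toRingHom detPoly) := by
  rw [AlgHom.toRingHom_eq_coe, RingHom.coe_coe, aeval_detPoly]
  exact isUnit_iff_ne_zero.2 hg

/-- **EVALUATION `ev_g : 𝒜 →ₐ[ℂ] ℂ` at a complex matrix `g` with `det g ≠ 0`** — `P·D^{−N} ↦ P(g)·det(g)^{−N}`; the restriction `res` of BATCH #7 (c) to `U(2)` ∕ `K_w` is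
`a ↦ (u ↦ ev_u a)`. [cite: LeeZhu1998, p. 5032] -/
def evalAt (g : Matrix (Fin 2) (Fin 2) ℂ) (hg : g.det ≠ 0) : Carrier →ₐ[ℂ] ℂ :=
  { IsLocalization.Away.lift detPoly (g := (MvPolynomial.aeval fun kl : Fin 2 × Fin 2 => g kl.1 kl.2).toRingHom) (isUnit_aeval_detPoly g hg) with
    commutes' := fun c => by
      simp only [AlgHom.toRingHom_eq_coe, RingHom.toMonoidHom_eq_coe, OneHom.toFun_eq_coe, MonoidHom.toOneHom_coe, MonoidHom.coe_coe]
      rw [IsScalarTower.algebraMap_apply ℂ (MvPolynomial (Fin 2 × Fin 2) ℂ) Carrier, IsLocalization.Away.lift_eq, RingHom.coe_coe, AlgHom.commutes] }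

/-- evaluation on the image of a polynomial is polynomial evaluation. [cite: LeeZhu1998, p. 5032] -/
theorem evalAt_algebraMap (g : Matrix (Fin 2) (Fin 2) ℂ) (hg : g.det ≠ 0) (P : MvPolynomial (Fin 2 × Fin 2) ℂ) :
    evalAt g hg (algebraMap (MvPolynomial (Fin 2 × Fin 2) ℂ) Carrier P) = MvPolynomial.aeval (fun kl : Fin 2 × Fin 2 => g kl.1 kl.2) P :=
  IsLocalization.Away.lift_eq detPoly (isUnit_aeval_detPoly g hg) P

/-- evaluation of a coordinate. [cite: LeeZhu1998, p. 5032] -/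
theorem evalAt_uMat (g : Matrix (Fin 2) (Fin 2) ℂ) (hg : g.det ≠ 0) (i j : Fin 2) : evalAt g hg (uMat i j) = g i j := by
  rw [uMat_apply, evalAt_algebraMap, MvPolynomial.aeval_X]

/-- evaluation of `D⁻¹` is `det(g)⁻¹`. [cite: LeeZhu1998, p. 5032] -/
theorem evalAt_dInv (g : Matrix (Fin 2) (Fin 2) ℂ) (hg : g.det ≠ 0) : evalAt g hg dInv = (g.det)⁻¹ := by
  have h := congrArg (evalAt g hg) det_uMat_mul_dInv
  rw [map_mul, map_one, det_uMat, evalAt_algebraMap, aeval_detPoly] at h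
  exact (eq_inv_of_mul_eq_one_right h)

end Summit.HodgeConjecture.HodgeConjecture.Cruxes.HLiu418.K2LiuU22CompactPictureDefs

end
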